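import Summits.AnomalousDissipation.AnomalousDissipation.Theorems.SawtoothPulseCascadeK1LocalisedCascadeHPieceBound

/-!
# K1loc explicit start, phase 1: THE PER-H-FIBRE CERTIFICATE («HFibreCert»)

Helper file of the prover lane on the crux `K1LocalisedCascade` (stmt-AnomalousDissipation-19491), route `SawtoothPulseCascade`
(arbiter A24-6 steps (3)–(5)).  `…VOJunkFrame.vo_junk_le_of_fibre_certs` reduces the V/O junk of the explicit phase-2 start to
per-H-fibre certificates `Σ_{n∈T_p} ω(p,n)‖𝓕b₁(p,n)‖² ≤ V_p`, `ω(p,n) = (467/45)·φ(|n|)/ℓ(|n|−8|p|)` (`φ` of `…VTwistMass`, the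
three levels `ℓ ∈ {1, 2/5, 1/9}`).  This file proves the certificate of ONE fibre from numerical data:
* `hfibre_cert`: for `p ≥ 0`, given the phase-1 energy evaluation `e`, the six source-group evaluations `v_g`
  (`…PhaseOneGroupEval`), windows `[n₁_k, n₂_k] ⊇ T_p ∩ piece_k` for the ten side pieces
  `|n| − 8p ∈ ±[25,56], ±[57,140], ±[141,200], ±[201,290], ±[291,399]`, mass data `(x,y,s)_{k,g}` satisfying the three-way side
  condition of `…HMassAuto` on the flagged pieces, and weights `wc ≥ Uφ(m_c)`, `w_k ≥ (Uφ(n₁_k)/ℓ_k − wc)⁺`, the layer-cake bound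
  `Σ_{n∈T_p} ω‖𝓕b₁(p,n)‖² ≤ V⁰ + ρ·R_p` with `V⁰ ≥ wc·e + Σ_k w_k·B_k` (`B_k` = the grouped Minkowski bound of `…HPieceBound.hpiece_le`
  or `e`), `ρ ≥ wc + Σ_k w_k·(10 or 1)`, `R_p = Σ'_{q∉S} ‖𝓕a₁(p,q)‖²`;
* `hfibre_symm`, `hrem_symm`: the fibre functional and `R_p` are even in `p` (real data);
* `sum_Icc_cert_single`, `sum_Icc_cert_merge`, `sum_Icc_symm_cert`: bookkeeping for adding the certificates over `p ∈ [−400,400]`.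
No definitions; nothing about the crux. [cite: Grafakos2014, Prop. 3.1.2 (5), Prop. 3.2.7 (3)] [problem: turb]
-/

-- `Summit.<Summit>.<Problem>`: single-conjunct summit, the duplicate namespace segment is deliberate.
set_option linter.dupNamespace false
set_option maxRecDepth 4000

noncomputable section

namespace Summit.AnomalousDissipation.AnomalousDissipation.Theorems.SawtoothPulseCascade.K1Start

open MeasureTheory Filter Topology UnitAddTorus Complex AddCircle
open scoped Real
open Literature.Analysis Literature.Analysis.FunctionSpaces Literature.Analysis.FunctionSpaces.Torus Literature.Analysis.FluidPDE
open Literature.Analysis.FluidPDE.ShearStage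
open Literature.Analysis.FluidPDE.SawtoothCascade Literature.Analysis.FluidPDE.SawtoothCascade.CascadeParams
open Summit.AnomalousDissipation.AnomalousDissipation.Theorems.SawtoothPulseCascade.K1Window

/-! ## §1 Bookkeeping over `p` -/

/-- A certificate for one fibre is a certificate for the one-point block. [folklore] -/
theorem sum_Icc_cert_single (F R : ℤ → ℝ) (a : ℤ) {A ρ : ℝ} (h : F a ≤ A + ρ * R a) :
    ∑ p ∈ Finset.Icc a a, F p ≤ A + ρ * ∑ p ∈ Finset.Icc a a, R p := by
  simpa using h

/-- Two adjacent block certificates merge. [folklore] -/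
theorem sum_Icc_cert_merge (F R : ℤ → ℝ) {a b b' c : ℤ} {A₁ A₂ ρ : ℝ} (hb : b + 1 = b') (hab : a ≤ b) (hbc : b' ≤ c)
    (h₁ : ∑ p ∈ Finset.Icc a b, F p ≤ A₁ + ρ * ∑ p ∈ Finset.Icc a b, R p)
    (h₂ : ∑ p ∈ Finset.Icc b' c, F p ≤ A₂ + ρ * ∑ p ∈ Finset.Icc b' c, R p) :
    ∑ p ∈ Finset.Icc a c, F p ≤ (A₁ + A₂) + ρ * ∑ p ∈ Finset.Icc a c, R p := by
  have hU : Finset.Icc a c = Finset.Icc a b ∪ Finset.Icc b' c := by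
    ext p; simp only [Finset.mem_union, Finset.mem_Icc]; omega
  have hD : Disjoint (Finset.Icc a b) (Finset.Icc b' c) :=
    Finset.disjoint_left.2 fun p h1 h2 => by rw [Finset.mem_Icc] at h1 h2; omega
  rw [hU, Finset.sum_union hD, Finset.sum_union hD]
  linarith

/-- **Symmetrisation**: for `F, R` even, a certificate at `p = 0` and one for `p ∈ [1,N]` give one for `p ∈ [−N,N]`. [folklore] -/
theorem sum_Icc_symm_cert (F R : ℤ → ℝ) (hF : ∀ p, F (-p) = F p) (hR : ∀ p, R (-p) = R p) (N : ℕ) {A₀ A ρ : ℝ}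
    (h₀ : F 0 ≤ A₀ + ρ * R 0) (h : ∑ p ∈ Finset.Icc (1 : ℤ) N, F p ≤ A + ρ * ∑ p ∈ Finset.Icc (1 : ℤ) N, R p) :
    ∑ p ∈ Finset.Icc (-(N : ℤ)) N, F p ≤ (A₀ + 2 * A) + ρ * ∑ p ∈ Finset.Icc (-(N : ℤ)) N, R p := by
  have hsplit : ∀ G : ℤ → ℝ, (∀ p, G (-p) = G p) →
      ∑ p ∈ Finset.Icc (-(N : ℤ)) N, G p = G 0 + 2 * ∑ p ∈ Finset.Icc (1 : ℤ) N, G p := by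
    intro G hG
    have hU : Finset.Icc (-(N : ℤ)) N = (Finset.Icc (-(N : ℤ)) (-1) ∪ {0}) ∪ Finset.Icc (1 : ℤ) N := by
      ext p; simp only [Finset.mem_union, Finset.mem_Icc, Finset.mem_singleton]; omega
    have hD1 : Disjoint (Finset.Icc (-(N : ℤ)) (-1)) {0} :=
      Finset.disjoint_left.2 fun p h1 h2 => by rw [Finset.mem_Icc] at h1; rw [Finset.mem_singleton] at h2; omega
    have hD2 : Disjoint (Finset.Icc (-(N : ℤ)) (-1) ∪ {0}) (Finset.Icc (1 : ℤ) N) :=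
      Finset.disjoint_left.2 fun p h1 h2 => by
        rw [Finset.mem_union, Finset.mem_Icc, Finset.mem_singleton] at h1; rw [Finset.mem_Icc] at h2; omega
    have hneg : ∑ p ∈ Finset.Icc (-(N : ℤ)) (-1), G p = ∑ p ∈ Finset.Icc (1 : ℤ) N, G p := by
      refine Finset.sum_equiv (Equiv.neg ℤ) (fun p => ?_) (fun p _ => ?_)
      · simp only [Equiv.neg_apply, Finset.mem_Icc]; omega
      · simp only [Equiv.neg_apply, hG]
    rw [hU, Finset.sum_union hD2, Finset.sum_union hD1, Finset.sum_singleton, hneg]; ring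
  rw [hsplit F hF, hsplit R hR]
  nlinarith

section Cascade

variable (P : CascadeParams) (hγ : P.γ = 8) (hN₀ : P.N₀ = 1) (hρN : P.ρN = 2) (hd : P.d = 2) (hδ₀ : 0 < P.δ₀)
  (hδ₀' : P.δ₀ ≤ (2 : ℝ)⁻¹ ^ 30) (a b : ℕ → UnitAddTorus (Fin 2) → ℝ) (h0 : a 0 = datum)
  (hb : ∀ j, b j = a j ∘ shearMap 0 1 (amp ⟨P.U j, P.U_periodic j, P.contDiff_U (P.δ_pos hδ₀ (by rw [hd]; norm_num) j)⟩ P.γ))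
  (hab : ∀ j, a (j + 1) = b j ∘ shearMap 1 0 (amp ⟨P.U j, P.U_periodic j, P.contDiff_U (P.δ_pos hδ₀ (by rw [hd]; norm_num) j)⟩ P.γ))

include hγ hN₀ hρN hd hδ₀' h0 hb hab

/-! ## §2 Evenness in `p` -/

omit hγ hN₀ hρN hd hδ₀' h0 hb hab in
/-- **The fibre functional is even in `p`** (`b₁` is real, so `|𝓕b₁(−k)| = |𝓕b₁(k)|`; the tube and the weight only see `|p|, |n|`). [folklore] -/
theorem hfibre_symm (p : ℤ) :
    ∑ n ∈ ((Finset.Icc (-3600 : ℤ) 3600).filter (fun n => 120 ≤ |n|)).filter (fun n => |(8 * |-p| - |n|)| < 400),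
      467 / 45 * (if ((|n|) : ℝ) < 200 then 0.0396607 / (((|n|) : ℝ) - 108.5) else 0.0768758 / (((|n|) : ℝ) - 22)) / (if |(|n| - 8 * |-p|)| ≤ 24 then (1 : ℝ) else if |(|n| - 8 * |-p|)| ≤ 56 then 2 / 5 else 1 / 9) * ‖mFourierCoeff (fun x => (b 1 x : ℂ)) ![-p, n]‖ ^ 2 =
    ∑ n ∈ ((Finset.Icc (-3600 : ℤ) 3600).filter (fun n => 120 ≤ |n|)).filter (fun n => |(8 * |p| - |n|)| < 400),
      467 / 45 * (if ((|n|) : ℝ) < 200 then 0.0396607 / (((|n|) : ℝ) - 108.5) else 0.0768758 / (((|n|) : ℝ) - 22)) / (if |(|n| - 8 * |p|)| ≤ 24 then (1 : ℝ) else if |(|n| - 8 * |p|)| ≤ 56 then 2 / 5 else 1 / 9) * ‖mFourierCoeff (fun x => (b 1 x : ℂ)) ![p, n]‖ ^ 2 := by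
  simp only [abs_neg]
  refine Finset.sum_equiv (Equiv.neg ℤ) (fun n => ?_) (fun n _ => ?_)
  · simp only [Equiv.neg_apply, Finset.mem_filter, Finset.mem_Icc, abs_neg]; omega
  · simp only [Equiv.neg_apply, abs_neg, Int.cast_neg]
    have hk : (-![p, -n] : Fin 2 → ℤ) = ![-p, n] := by ext i; fin_cases i <;> simp
    rw [← hk, norm_mFourierCoeff_neg_real (b 1) ![p, -n]]

omit hγ hN₀ hρN hd hδ₀' h0 hb hab in
/-- **The source remainder `R_p` is even in `p`.** [folklore] -/
theorem hrem_symm (p : ℤ) :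
    ∑' q : ℤ, (if q ∈ (Finset.Icc (-(100 : ℤ)) 100).filter (fun q => 1 ≤ |q|) then 0 else ‖mFourierCoeff (fun x => (a 1 x : ℂ)) ![-p, q]‖ ^ 2) = ∑' q : ℤ, (if q ∈ (Finset.Icc (-(100 : ℤ)) 100).filter (fun q => 1 ≤ |q|) then 0 else ‖mFourierCoeff (fun x => (a 1 x : ℂ)) ![p, q]‖ ^ 2) := by
  rw [← (Equiv.neg ℤ).tsum_eq]
  refine tsum_congr fun q => ?_
  have hmem : (-q ∈ (Finset.Icc (-(100 : ℤ)) 100).filter (fun q => 1 ≤ |q|)) ↔ q ∈ (Finset.Icc (-(100 : ℤ)) 100).filter (fun q => 1 ≤ |q|) := by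
    simp only [Finset.mem_filter, Finset.mem_Icc, abs_neg]; omega
  simp only [Equiv.neg_apply]
  simp only [hmem]
  split_ifs
  · rfl
  · have hk : (![-p, -q] : Fin 2 → ℤ) = -![p, q] := by ext i; fin_cases i <;> simp
    rw [hk, norm_mFourierCoeff_neg_real (a 1) ![p, q]]

/-! ## §3 The certificate of one fibre -/

/-- **Per-H-fibre certificate** of the V/O junk bound (`p ≥ 0`): with the energy evaluation `e`, group evaluations `v`,
side-piece windows `[n₁_k, n₂_k]`, mass data `x, y, s` and flags, weights `wc, w` and totals `V⁰, ρ` as described in the file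
header, `Σ_{n∈T_p} (467/45)φ(|n|)/ℓ · ‖𝓕b₁(p,n)‖² ≤ V⁰ + ρ·R_p`. [cite: Grafakos2014, Prop. 3.1.2 (5), Prop. 3.2.7 (3)] -/
theorem hfibre_cert (p : ℤ) (hp : 0 ≤ p) (e : ℝ) (v : Fin 6 → ℝ) (n₁ n₂ : Fin 10 → ℤ) (mc : ℤ)
    (x y s : Fin 10 → Fin 6 → ℝ) (flag : Fin 10 → Bool) (wc : ℝ) (w : Fin 10 → ℝ) (V0 ρ : ℝ)
    (he : ∑ i ∈ Finset.range 100, 2 * (1 / 2 * ((if ((i : ℤ) + 1) = 8 ∨ ((i : ℤ) + 1) = -8 then (1 / 2 : ℝ)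
          else if ((i : ℤ) + 1) % 2 = 0 then 0 else 16 * 0.31831 / |64 - ((((i : ℤ) + 1 : ℤ)) : ℝ) ^ 2|) + (2 : ℝ)⁻¹ ^ 25) *
        ((if 8 * ((i : ℤ) + 1) + (p + 1) = 0 ∨ 8 * ((i : ℤ) + 1) - (p + 1) = 0 then (1 / 2 : ℝ) else if (p + 1) % 2 = 0 then 0
            else 16 * |((((i : ℤ) + 1 : ℤ)) : ℝ)| * 0.31831 / |64 * ((((i : ℤ) + 1 : ℤ)) : ℝ) ^ 2 - ((p + 1 : ℤ) : ℝ) ^ 2|) +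
          (if 8 * ((i : ℤ) + 1) + (p - 1) = 0 ∨ 8 * ((i : ℤ) + 1) - (p - 1) = 0 then (1 / 2 : ℝ) else if (p - 1) % 2 = 0 then 0
            else 16 * |((((i : ℤ) + 1 : ℤ)) : ℝ)| * 0.31831 / |64 * ((((i : ℤ) + 1 : ℤ)) : ℝ) ^ 2 - ((p - 1 : ℤ) : ℝ) ^ 2|) +
          2 * |((((i : ℤ) + 1 : ℤ)) : ℝ)| * (2 : ℝ)⁻¹ ^ 25)) ^ 2 ≤ e)
    (hv : ∀ g : Fin 6, ∑ i ∈ Finset.range (((![4, 8, 14, 22, 36, 100] : Fin 6 → ℕ) g) - ((![0, 4, 8, 14, 22, 36] : Fin 6 → ℕ) g)), 2 * (1 / 2 * ((if ((((![0, 4, 8, 14, 22, 36] : Fin 6 → ℕ) g) : ℤ) + 1 + i) = 8 ∨ ((((![0, 4, 8, 14, 22, 36] : Fin 6 → ℕ) g) : ℤ) + 1 + i) = -8 then (1 / 2 : ℝ)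
          else if ((((![0, 4, 8, 14, 22, 36] : Fin 6 → ℕ) g) : ℤ) + 1 + i) % 2 = 0 then 0 else 16 * 0.31831 / |64 - ((((((![0, 4, 8, 14, 22, 36] : Fin 6 → ℕ) g) : ℤ) + 1 + i : ℤ)) : ℝ) ^ 2|) + (2 : ℝ)⁻¹ ^ 25) *
        ((if 8 * ((((![0, 4, 8, 14, 22, 36] : Fin 6 → ℕ) g) : ℤ) + 1 + i) + (p + 1) = 0 ∨ 8 * ((((![0, 4, 8, 14, 22, 36] : Fin 6 → ℕ) g) : ℤ) + 1 + i) - (p + 1) = 0 then (1 / 2 : ℝ) else if (p + 1) % 2 = 0 then 0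
            else 16 * |((((((![0, 4, 8, 14, 22, 36] : Fin 6 → ℕ) g) : ℤ) + 1 + i : ℤ)) : ℝ)| * 0.31831 / |64 * ((((((![0, 4, 8, 14, 22, 36] : Fin 6 → ℕ) g) : ℤ) + 1 + i : ℤ)) : ℝ) ^ 2 - ((p + 1 : ℤ) : ℝ) ^ 2|) +
          (if 8 * ((((![0, 4, 8, 14, 22, 36] : Fin 6 → ℕ) g) : ℤ) + 1 + i) + (p - 1) = 0 ∨ 8 * ((((![0, 4, 8, 14, 22, 36] : Fin 6 → ℕ) g) : ℤ) + 1 + i) - (p - 1) = 0 then (1 / 2 : ℝ) else if (p - 1) % 2 = 0 then 0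
            else 16 * |((((((![0, 4, 8, 14, 22, 36] : Fin 6 → ℕ) g) : ℤ) + 1 + i : ℤ)) : ℝ)| * 0.31831 / |64 * ((((((![0, 4, 8, 14, 22, 36] : Fin 6 → ℕ) g) : ℤ) + 1 + i : ℤ)) : ℝ) ^ 2 - ((p - 1 : ℤ) : ℝ) ^ 2|) +
          2 * |((((((![0, 4, 8, 14, 22, 36] : Fin 6 → ℕ) g) : ℤ) + 1 + i : ℤ)) : ℝ)| * (2 : ℝ)⁻¹ ^ 25)) ≤ v g)
    (hn : ∀ k : Fin 10, 120 ≤ n₁ k ∧ (n₁ k ≤ 120 ∨ n₁ k ≤ 8 * p + (![25, -56, 57, -140, 141, -200, 201, -290, 291, -399] : Fin 10 → ℤ) k) ∧ (3600 ≤ n₂ k ∨ 8 * p + (![56, -25, 140, -57, 200, -141, 290, -201, 399, -291] : Fin 10 → ℤ) k ≤ n₂ k))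
    (hmc : 120 ≤ mc ∧ (mc ≤ 120 ∨ mc + 24 ≤ 8 * p))
    (hflag : ∀ k : Fin 10, flag k = true → 1 ≤ p)
    (hmass : ∀ k : Fin 10, ∀ g : Fin 6, flag k = false ∨ ((1 ≤ s k g) ∨
      (0 ≤ x k g ∧ 0 ≤ y k g ∧ (n₁ k - ((![4, 8, 14, 22, 36, 100] : Fin 6 → ℕ) g) - 2) / 4 ≤ (n₂ k + ((![4, 8, 14, 22, 36, 100] : Fin 6 → ℕ) g) + 5) / 4 ∧
        4 * ((n₂ k + ((![4, 8, 14, 22, 36, 100] : Fin 6 → ℕ) g) + 5) / 4) < 8 * p ∧ 0 ≤ n₁ k - ((![4, 8, 14, 22, 36, 100] : Fin 6 → ℕ) g) - 2 ∧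
        1 / (8 * (p : ℝ) - 4 * (((n₂ k + ((![4, 8, 14, 22, 36, 100] : Fin 6 → ℕ) g) + 5) / 4 : ℤ) : ℝ)) -
          1 / (8 * (p : ℝ) - 4 * (((n₁ k - ((![4, 8, 14, 22, 36, 100] : Fin 6 → ℕ) g) - 2) / 4 : ℤ) : ℝ)) ≤ x k g ^ 2 ∧
        1 / (8 * (p : ℝ) + 4 * (((n₁ k - ((![4, 8, 14, 22, 36, 100] : Fin 6 → ℕ) g) - 2) / 4 : ℤ) : ℝ)) -
          1 / (8 * (p : ℝ) + 4 * (((n₂ k + ((![4, 8, 14, 22, 36, 100] : Fin 6 → ℕ) g) + 5) / 4 : ℤ) : ℝ)) ≤ y k g ^ 2 ∧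
        0.3184 * (x k g + y k g) ≤ s k g) ∨
      (0 ≤ s k g ∧ (n₁ k - ((![4, 8, 14, 22, 36, 100] : Fin 6 → ℕ) g) - 2) / 4 ≤ (n₂ k + ((![4, 8, 14, 22, 36, 100] : Fin 6 → ℕ) g) + 5) / 4 ∧
        8 * p < 4 * ((n₁ k - ((![4, 8, 14, 22, 36, 100] : Fin 6 → ℕ) g) - 2) / 4) ∧
        0.101322 * (1 / (4 * (((n₁ k - ((![4, 8, 14, 22, 36, 100] : Fin 6 → ℕ) g) - 2) / 4 : ℤ) : ℝ) - 8 * p) -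
          1 / (4 * (((n₂ k + ((![4, 8, 14, 22, 36, 100] : Fin 6 → ℕ) g) + 5) / 4 : ℤ) : ℝ) - 8 * p)) ≤ s k g ^ 2)))
    (hwc : 467 / 45 * (if ((mc : ℤ) : ℝ) < 200 then 0.0396607 / (((mc : ℤ) : ℝ) - 108.5) else 0.0768758 / (((mc : ℤ) : ℝ) - 22)) ≤ wc)
    (hw : ∀ k : Fin 10, 0 ≤ w k ∧ 467 / 45 * (if ((n₁ k : ℤ) : ℝ) < 200 then 0.0396607 / (((n₁ k : ℤ) : ℝ) - 108.5) else 0.0768758 / (((n₁ k : ℤ) : ℝ) - 22)) * (![5 / 2, 5 / 2, 9, 9, 9, 9, 9, 9, 9, 9] : Fin 10 → ℝ) k - wc ≤ w k)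
    (hV0 : wc * e + ∑ k : Fin 10, w k * (if flag k = true then 5 / 2 * (∑ g : Fin 6, v g * (s k g + (2 : ℝ)⁻¹ ^ 27 * p)) ^ 2 else e) ≤ V0)
    (hρ : wc + ∑ k : Fin 10, w k * (if flag k = true then (10 : ℝ) else 1) ≤ ρ) :
    ∑ n ∈ ((Finset.Icc (-3600 : ℤ) 3600).filter (fun n => 120 ≤ |n|)).filter (fun n => |(8 * |p| - |n|)| < 400),
      467 / 45 * (if ((|n|) : ℝ) < 200 then 0.0396607 / (((|n|) : ℝ) - 108.5) else 0.0768758 / (((|n|) : ℝ) - 22)) / (if |(|n| - 8 * |p|)| ≤ 24 then (1 : ℝ) else if |(|n| - 8 * |p|)| ≤ 56 then 2 / 5 else 1 / 9) * ‖mFourierCoeff (fun x => (b 1 x : ℂ)) ![p, n]‖ ^ 2 ≤ V0 + ρ * ∑' q : ℤ, (if q ∈ (Finset.Icc (-(100 : ℤ)) 100).filter (fun q => 1 ≤ |q|) then 0 else ‖mFourierCoeff (fun x => (a 1 x : ℂ)) ![p, q]‖ ^ 2) := by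
  classical
  have hd' : 0 < P.d := by rw [hd]; norm_num
  have hp' : |p| = p := abs_of_nonneg hp
  set S : Finset ℤ := (Finset.Icc (-(100 : ℤ)) 100).filter (fun q => 1 ≤ |q|) with hS
  set R : ℝ := ∑' q : ℤ, (if q ∈ (Finset.Icc (-(100 : ℤ)) 100).filter (fun q => 1 ≤ |q|) then 0 else ‖mFourierCoeff (fun x => (a 1 x : ℂ)) ![p, q]‖ ^ 2) with hRdef
  have hR0 : 0 ≤ R := tsum_nonneg fun q => by split_ifs <;> positivity
  obtain ⟨T, hT⟩ : ∃ T : Finset ℤ, T = ((Finset.Icc (-3600 : ℤ) 3600).filter (fun n => 120 ≤ |n|)).filter (fun n => |(8 * |p| - |n|)| < 400) := ⟨_, rfl⟩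
  rw [← hT]
  obtain ⟨c, hc⟩ : ∃ c : ℤ → ℝ, ∀ n, c n = ‖mFourierCoeff (fun x => (b 1 x : ℂ)) ![p, n]‖ ^ 2 := ⟨_, fun _ => rfl⟩
  have hc0 : ∀ n, 0 ≤ c n := fun n => by rw [hc]; exact sq_nonneg _
  simp only [← hc]
  -- §a energies: whole fibre and pieces
  have he' := phaseOne_energy_le_eval P hγ hN₀ hδ₀ hδ₀' hd' a b h0 (hb 0) (hab 0) p 100 he
  push_cast at he'
  have htot : ∑ n ∈ T, c n ≤ e + R := by
    have h := hfibre_total_le P hd hδ₀ a b h0 hb hab p T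
    simp only [← hc] at h
    rw [← hRdef] at h
    linarith
  have hQ : ∀ g : Fin 6, (![0, 4, 8, 14, 22, 36] : Fin 6 → ℕ) g ≤ (![4, 8, 14, 22, 36, 100] : Fin 6 → ℕ) g ∧
      (![4, 8, 14, 22, 36, 100] : Fin 6 → ℕ) g ≤ 100 := by decide
  have hpiece : ∀ k : Fin 10, ∑ n ∈ T.filter (fun n => n₁ k ≤ |n| ∧ |n| ≤ n₂ k), c n ≤
      (if flag k = true then 5 / 2 * (∑ g : Fin 6, v g * (s k g + (2 : ℝ)⁻¹ ^ 27 * p)) ^ 2 else e) +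
        (if flag k = true then (10 : ℝ) else 1) * R := by
    intro k
    cases hfk : flag k
    · simp only [Bool.false_eq_true, if_false, one_mul]
      exact (Finset.sum_le_sum_of_subset_of_nonneg (Finset.filter_subset _ T) fun n _ _ => hc0 n).trans htot
    · simp only [if_true]
      have hp1 : 1 ≤ p := hflag k hfk
      have hv' : ∀ g : Fin 6, ∑ q ∈ S.filter (fun q => (((![0, 4, 8, 14, 22, 36] : Fin 6 → ℕ) g : ℕ) : ℤ) < |q| ∧
          |q| ≤ (((![4, 8, 14, 22, 36, 100] : Fin 6 → ℕ) g : ℕ) : ℤ)), ‖mFourierCoeff (fun x => (a 1 x : ℂ)) ![p, q]‖ ≤ v g :=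
        fun g => phaseOne_group_le_eval P hγ hN₀ hδ₀ hδ₀' hd' a b h0 (hb 0) (hab 0) p (hQ g).1 (hQ g).2 (hv g)
      have hm' : ∀ g : Fin 6, (1 ≤ s k g) ∨
      (0 ≤ x k g ∧ 0 ≤ y k g ∧ (n₁ k - ((![4, 8, 14, 22, 36, 100] : Fin 6 → ℕ) g) - 2) / 4 ≤ (n₂ k + ((![4, 8, 14, 22, 36, 100] : Fin 6 → ℕ) g) + 5) / 4 ∧
        4 * ((n₂ k + ((![4, 8, 14, 22, 36, 100] : Fin 6 → ℕ) g) + 5) / 4) < 8 * p ∧ 0 ≤ n₁ k - ((![4, 8, 14, 22, 36, 100] : Fin 6 → ℕ) g) - 2 ∧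
        1 / (8 * (p : ℝ) - 4 * (((n₂ k + ((![4, 8, 14, 22, 36, 100] : Fin 6 → ℕ) g) + 5) / 4 : ℤ) : ℝ)) -
          1 / (8 * (p : ℝ) - 4 * (((n₁ k - ((![4, 8, 14, 22, 36, 100] : Fin 6 → ℕ) g) - 2) / 4 : ℤ) : ℝ)) ≤ x k g ^ 2 ∧
        1 / (8 * (p : ℝ) + 4 * (((n₁ k - ((![4, 8, 14, 22, 36, 100] : Fin 6 → ℕ) g) - 2) / 4 : ℤ) : ℝ)) -
          1 / (8 * (p : ℝ) + 4 * (((n₂ k + ((![4, 8, 14, 22, 36, 100] : Fin 6 → ℕ) g) + 5) / 4 : ℤ) : ℝ)) ≤ y k g ^ 2 ∧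
        0.3184 * (x k g + y k g) ≤ s k g) ∨
      (0 ≤ s k g ∧ (n₁ k - ((![4, 8, 14, 22, 36, 100] : Fin 6 → ℕ) g) - 2) / 4 ≤ (n₂ k + ((![4, 8, 14, 22, 36, 100] : Fin 6 → ℕ) g) + 5) / 4 ∧
        8 * p < 4 * ((n₁ k - ((![4, 8, 14, 22, 36, 100] : Fin 6 → ℕ) g) - 2) / 4) ∧
        0.101322 * (1 / (4 * (((n₁ k - ((![4, 8, 14, 22, 36, 100] : Fin 6 → ℕ) g) - 2) / 4 : ℤ) : ℝ) - 8 * p) -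
          1 / (4 * (((n₂ k + ((![4, 8, 14, 22, 36, 100] : Fin 6 → ℕ) g) + 5) / 4 : ℤ) : ℝ) - 8 * p)) ≤ s k g ^ 2) := fun g => (hmass k g).resolve_left (by simp [hfk])
      have h := hpiece_le P hγ hN₀ hρN hd hδ₀ hδ₀' a b h0 hb hab p hp1 (n₁ k) (n₂ k) (by linarith [(hn k).1])
        v (x k) (y k) (s k) hv' hm' T
      simp only [← hc] at h
      exact h
  -- §b the pointwise weight bound (layer cake over the pieces)
  have hφle : ∀ n m : ℤ, 120 ≤ m → m ≤ |n| →
      (if |(n : ℝ)| < 200 then 0.0396607 / (|(n : ℝ)| - 108.5) else 0.0768758 / (|(n : ℝ)| - 22) : ℝ) ≤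
        (if ((m : ℤ) : ℝ) < 200 then 0.0396607 / (((m : ℤ) : ℝ) - 108.5) else 0.0768758 / (((m : ℤ) : ℝ) - 22)) :=
    fun n m hm hmn => phiV_antitone (by exact_mod_cast hm) (by exact_mod_cast hmn)
  have hφ0 : ∀ n : ℤ, 120 ≤ |n| →
      0 ≤ (if |(n : ℝ)| < 200 then 0.0396607 / (|(n : ℝ)| - 108.5) else 0.0768758 / (|(n : ℝ)| - 22) : ℝ) :=
    fun n hn => (phiV_pos (by exact_mod_cast hn)).le
  have hind0 : ∀ (n : ℤ) (k : Fin 10), 0 ≤ w k * (if n₁ k ≤ |n| ∧ |n| ≤ n₂ k then (1 : ℝ) else 0) :=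
    fun n k => mul_nonneg (hw k).1 (by split_ifs <;> norm_num)
  have hS0 : ∀ n : ℤ, 0 ≤ ∑ k : Fin 10, w k * (if n₁ k ≤ |n| ∧ |n| ≤ n₂ k then (1 : ℝ) else 0) :=
    fun n => Finset.sum_nonneg fun k _ => hind0 n k
  have hS1 : ∀ (n : ℤ) (k₀ : Fin 10), (n₁ k₀ ≤ |n| ∧ |n| ≤ n₂ k₀) →
      w k₀ ≤ ∑ k : Fin 10, w k * (if n₁ k ≤ |n| ∧ |n| ≤ n₂ k then (1 : ℝ) else 0) := by
    intro n k₀ h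
    calc w k₀ = w k₀ * (if n₁ k₀ ≤ |n| ∧ |n| ≤ n₂ k₀ then (1 : ℝ) else 0) := by rw [if_pos h, mul_one]
      _ ≤ _ := Finset.single_le_sum (fun k _ => hind0 n k) (Finset.mem_univ k₀)
  have hIL : ∀ k : Fin 10, 0 ≤ (![5 / 2, 5 / 2, 9, 9, 9, 9, 9, 9, 9, 9] : Fin 10 → ℝ) k := by
    intro k; fin_cases k <;> norm_num
  have hwc0 : 0 ≤ wc := le_trans (mul_nonneg (by norm_num) (phiV_pos (by exact_mod_cast hmc.1)).le) hwc
  -- one piece: if `n ∈ T` lies in the window of piece `k` then `Uφ(|n|)·IL_k ≤ wc + Σ_k w_k 𝟙_k(n)`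
  have hcase : ∀ n : ℤ, 120 ≤ |n| → ∀ k : Fin 10, n₁ k ≤ |n| → |n| ≤ n₂ k →
      467 / 45 * (if |(n : ℝ)| < 200 then 0.0396607 / (|(n : ℝ)| - 108.5) else 0.0768758 / (|(n : ℝ)| - 22) : ℝ) * (![5 / 2, 5 / 2, 9, 9, 9, 9, 9, 9, 9, 9] : Fin 10 → ℝ) k ≤
        wc + ∑ k : Fin 10, w k * (if n₁ k ≤ |n| ∧ |n| ≤ n₂ k then (1 : ℝ) else 0) := by
    intro n hn120 k hk1 hk2
    have h1 := hφle n (n₁ k) (hn k).1 hk1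
    have h2 := hS1 n k ⟨hk1, hk2⟩
    have h3 := (hw k).2
    have h4 : 467 / 45 * (if |(n : ℝ)| < 200 then 0.0396607 / (|(n : ℝ)| - 108.5) else 0.0768758 / (|(n : ℝ)| - 22) : ℝ) * (![5 / 2, 5 / 2, 9, 9, 9, 9, 9, 9, 9, 9] : Fin 10 → ℝ) k ≤
        467 / 45 * (if (((n₁ k) : ℤ) : ℝ) < 200 then 0.0396607 / ((((n₁ k) : ℤ) : ℝ) - 108.5)
          else 0.0768758 / ((((n₁ k) : ℤ) : ℝ) - 22)) * (![5 / 2, 5 / 2, 9, 9, 9, 9, 9, 9, 9, 9] : Fin 10 → ℝ) k :=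
      mul_le_mul_of_nonneg_right (mul_le_mul_of_nonneg_left h1 (by norm_num)) (hIL k)
    linarith
  have hpt : ∀ n ∈ T, 467 / 45 * (if |(n : ℝ)| < 200 then 0.0396607 / (|(n : ℝ)| - 108.5) else 0.0768758 / (|(n : ℝ)| - 22) : ℝ) / (if |(|n| - 8 * |p|)| ≤ 24 then (1 : ℝ) else if |(|n| - 8 * |p|)| ≤ 56 then 2 / 5 else 1 / 9) ≤
      wc + ∑ k : Fin 10, w k * (if n₁ k ≤ |n| ∧ |n| ≤ n₂ k then (1 : ℝ) else 0) := by
    intro n hnT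
    rw [hT, Finset.mem_filter, Finset.mem_filter, Finset.mem_Icc, hp'] at hnT
    obtain ⟨⟨hn36, hn120⟩, htube⟩ := hnT
    have hnle : |n| ≤ 3600 := abs_le.2 ⟨hn36.1, hn36.2⟩
    have htube' := abs_lt.1 htube
    have ha1 := abs_choice (|n| - 8 * p); have ha2 := abs_nonneg (|n| - 8 * p)
    rw [hp']
    have hφn := hφ0 n hn120
    -- the eleven pieces of the tube
    have hsplit : |(|n| - 8 * p)| ≤ 24 ∨ (25 ≤ |n| - 8 * p ∧ |n| - 8 * p ≤ 56) ∨ (-56 ≤ |n| - 8 * p ∧ |n| - 8 * p ≤ -25) ∨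
        (57 ≤ |n| - 8 * p ∧ |n| - 8 * p ≤ 140) ∨ (-140 ≤ |n| - 8 * p ∧ |n| - 8 * p ≤ -57) ∨
        (141 ≤ |n| - 8 * p ∧ |n| - 8 * p ≤ 200) ∨ (-200 ≤ |n| - 8 * p ∧ |n| - 8 * p ≤ -141) ∨
        (201 ≤ |n| - 8 * p ∧ |n| - 8 * p ≤ 290) ∨ (-290 ≤ |n| - 8 * p ∧ |n| - 8 * p ≤ -201) ∨
        (291 ≤ |n| - 8 * p ∧ |n| - 8 * p ≤ 399) ∨ (-399 ≤ |n| - 8 * p ∧ |n| - 8 * p ≤ -291) := by omega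
    rcases hsplit with h | h | h | h | h | h | h | h | h | h | h
    · -- central piece: `ℓ = 1`, `φ(|n|) ≤ φ(mc) `
      rw [if_pos h, div_one]
      have h1 := hφle n mc hmc.1 (by rcases hmc.2 with h' | h' <;> omega)
      linarith [hS0 n]
    · -- piece 0: `|n| − 8p ∈ [25, 56]`, level `2/5`
      have h24 : ¬ |(|n| - 8 * p)| ≤ 24 := by omega
      have h56 : |(|n| - 8 * p)| ≤ 56 := by omega
      rw [if_neg h24, if_pos h56]
      have hnk := hn 0; simp only [Fin.isValue, Matrix.cons_val] at hnk
      have hc' := hcase n hn120 0 (by omega) (by omega); simp only [Fin.isValue, Matrix.cons_val] at hc'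
      exact le_trans (le_of_eq (by ring)) hc'
    · -- piece 1: `|n| − 8p ∈ [-56, -25]`, level `2/5`
      have h24 : ¬ |(|n| - 8 * p)| ≤ 24 := by omega
      have h56 : |(|n| - 8 * p)| ≤ 56 := by omega
      rw [if_neg h24, if_pos h56]
      have hnk := hn 1; simp only [Fin.isValue, Matrix.cons_val] at hnk
      have hc' := hcase n hn120 1 (by omega) (by omega); simp only [Fin.isValue, Matrix.cons_val] at hc'
      exact le_trans (le_of_eq (by ring)) hc'
    · -- piece 2: `|n| − 8p ∈ [57, 140]`, level `1/9`
      have h24 : ¬ |(|n| - 8 * p)| ≤ 24 := by omega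
      have h56 : ¬ |(|n| - 8 * p)| ≤ 56 := by omega
      rw [if_neg h24, if_neg h56]
      have hnk := hn 2; simp only [Fin.isValue, Matrix.cons_val] at hnk
      have hc' := hcase n hn120 2 (by omega) (by omega); simp only [Fin.isValue, Matrix.cons_val] at hc'
      exact le_trans (le_of_eq (by ring)) hc'
    · -- piece 3: `|n| − 8p ∈ [-140, -57]`, level `1/9`
      have h24 : ¬ |(|n| - 8 * p)| ≤ 24 := by omega
      have h56 : ¬ |(|n| - 8 * p)| ≤ 56 := by omega
      rw [if_neg h24, if_neg h56]
      have hnk := hn 3; simp only [Fin.isValue, Matrix.cons_val] at hnk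
      have hc' := hcase n hn120 3 (by omega) (by omega); simp only [Fin.isValue, Matrix.cons_val] at hc'
      exact le_trans (le_of_eq (by ring)) hc'
    · -- piece 4: `|n| − 8p ∈ [141, 200]`, level `1/9`
      have h24 : ¬ |(|n| - 8 * p)| ≤ 24 := by omega
      have h56 : ¬ |(|n| - 8 * p)| ≤ 56 := by omega
      rw [if_neg h24, if_neg h56]
      have hnk := hn 4; simp only [Fin.isValue, Matrix.cons_val] at hnk
      have hc' := hcase n hn120 4 (by omega) (by omega); simp only [Fin.isValue, Matrix.cons_val] at hc'
      exact le_trans (le_of_eq (by ring)) hc'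
    · -- piece 5: `|n| − 8p ∈ [-200, -141]`, level `1/9`
      have h24 : ¬ |(|n| - 8 * p)| ≤ 24 := by omega
      have h56 : ¬ |(|n| - 8 * p)| ≤ 56 := by omega
      rw [if_neg h24, if_neg h56]
      have hnk := hn 5; simp only [Fin.isValue, Matrix.cons_val] at hnk
      have hc' := hcase n hn120 5 (by omega) (by omega); simp only [Fin.isValue, Matrix.cons_val] at hc'
      exact le_trans (le_of_eq (by ring)) hc'
    · -- piece 6: `|n| − 8p ∈ [201, 290]`, level `1/9`
      have h24 : ¬ |(|n| - 8 * p)| ≤ 24 := by omega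
      have h56 : ¬ |(|n| - 8 * p)| ≤ 56 := by omega
      rw [if_neg h24, if_neg h56]
      have hnk := hn 6; simp only [Fin.isValue, Matrix.cons_val] at hnk
      have hc' := hcase n hn120 6 (by omega) (by omega); simp only [Fin.isValue, Matrix.cons_val] at hc'
      exact le_trans (le_of_eq (by ring)) hc'
    · -- piece 7: `|n| − 8p ∈ [-290, -201]`, level `1/9`
      have h24 : ¬ |(|n| - 8 * p)| ≤ 24 := by omega
      have h56 : ¬ |(|n| - 8 * p)| ≤ 56 := by omega
      rw [if_neg h24, if_neg h56]
      have hnk := hn 7; simp only [Fin.isValue, Matrix.cons_val] at hnk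
      have hc' := hcase n hn120 7 (by omega) (by omega); simp only [Fin.isValue, Matrix.cons_val] at hc'
      exact le_trans (le_of_eq (by ring)) hc'
    · -- piece 8: `|n| − 8p ∈ [291, 399]`, level `1/9`
      have h24 : ¬ |(|n| - 8 * p)| ≤ 24 := by omega
      have h56 : ¬ |(|n| - 8 * p)| ≤ 56 := by omega
      rw [if_neg h24, if_neg h56]
      have hnk := hn 8; simp only [Fin.isValue, Matrix.cons_val] at hnk
      have hc' := hcase n hn120 8 (by omega) (by omega); simp only [Fin.isValue, Matrix.cons_val] at hc'
      exact le_trans (le_of_eq (by ring)) hc'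
    · -- piece 9: `|n| − 8p ∈ [-399, -291]`, level `1/9`
      have h24 : ¬ |(|n| - 8 * p)| ≤ 24 := by omega
      have h56 : ¬ |(|n| - 8 * p)| ≤ 56 := by omega
      rw [if_neg h24, if_neg h56]
      have hnk := hn 9; simp only [Fin.isValue, Matrix.cons_val] at hnk
      have hc' := hcase n hn120 9 (by omega) (by omega); simp only [Fin.isValue, Matrix.cons_val] at hc'
      exact le_trans (le_of_eq (by ring)) hc'

  -- §c summation
  have hmain : ∑ n ∈ T, 467 / 45 * (if |(n : ℝ)| < 200 then 0.0396607 / (|(n : ℝ)| - 108.5) else 0.0768758 / (|(n : ℝ)| - 22) : ℝ) / (if |(|n| - 8 * |p|)| ≤ 24 then (1 : ℝ) else if |(|n| - 8 * |p|)| ≤ 56 then 2 / 5 else 1 / 9) * c n ≤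
      ∑ n ∈ T, (wc + ∑ k : Fin 10, w k * (if n₁ k ≤ |n| ∧ |n| ≤ n₂ k then (1 : ℝ) else 0)) * c n :=
    Finset.sum_le_sum fun n hn => mul_le_mul_of_nonneg_right (hpt n hn) (hc0 n)
  have hexp : ∑ n ∈ T, (wc + ∑ k : Fin 10, w k * (if n₁ k ≤ |n| ∧ |n| ≤ n₂ k then (1 : ℝ) else 0)) * c n =
      wc * ∑ n ∈ T, c n + ∑ k : Fin 10, w k * ∑ n ∈ T.filter (fun n => n₁ k ≤ |n| ∧ |n| ≤ n₂ k), c n := by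
    have e1 : ∀ n ∈ T, (wc + ∑ k : Fin 10, w k * (if n₁ k ≤ |n| ∧ |n| ≤ n₂ k then (1 : ℝ) else 0)) * c n =
        wc * c n + ∑ k : Fin 10, w k * ((if n₁ k ≤ |n| ∧ |n| ≤ n₂ k then (1 : ℝ) else 0) * c n) := by
      intro n _
      rw [add_mul, Finset.sum_mul]
      congr 1
      exact Finset.sum_congr rfl fun k _ => by ring
    have e2 := Finset.sum_congr rfl e1
    have e3 : ∑ n ∈ T, (wc * c n + ∑ k : Fin 10, w k * ((if n₁ k ≤ |n| ∧ |n| ≤ n₂ k then (1 : ℝ) else 0) * c n)) =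
        ∑ n ∈ T, wc * c n + ∑ n ∈ T, ∑ k : Fin 10, w k * ((if n₁ k ≤ |n| ∧ |n| ≤ n₂ k then (1 : ℝ) else 0) * c n) :=
      Finset.sum_add_distrib
    have e4 : ∑ n ∈ T, wc * c n = wc * ∑ n ∈ T, c n := (Finset.mul_sum _ _ _).symm
    have e5 : ∑ n ∈ T, ∑ k : Fin 10, w k * ((if n₁ k ≤ |n| ∧ |n| ≤ n₂ k then (1 : ℝ) else 0) * c n) =
        ∑ k : Fin 10, ∑ n ∈ T, w k * ((if n₁ k ≤ |n| ∧ |n| ≤ n₂ k then (1 : ℝ) else 0) * c n) := Finset.sum_comm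
    have e6 : ∀ k : Fin 10, ∑ n ∈ T, w k * ((if n₁ k ≤ |n| ∧ |n| ≤ n₂ k then (1 : ℝ) else 0) * c n) =
        w k * ∑ n ∈ T.filter (fun n => n₁ k ≤ |n| ∧ |n| ≤ n₂ k), c n := by
      intro k
      rw [Finset.mul_sum, Finset.sum_filter]
      exact Finset.sum_congr rfl fun n _ => by split_ifs <;> simp
    rw [e2, e3, e4, e5, Finset.sum_congr rfl fun k _ => e6 k]
  have hsum2 : ∑ k : Fin 10, w k * ∑ n ∈ T.filter (fun n => n₁ k ≤ |n| ∧ |n| ≤ n₂ k), c n ≤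
      ∑ k : Fin 10, w k * ((if flag k = true then 5 / 2 * (∑ g : Fin 6, v g * (s k g + (2 : ℝ)⁻¹ ^ 27 * p)) ^ 2 else e) +
        (if flag k = true then (10 : ℝ) else 1) * R) :=
    Finset.sum_le_sum fun k _ => mul_le_mul_of_nonneg_left (hpiece k) (hw k).1
  have halg : ∑ k : Fin 10, w k * ((if flag k = true then 5 / 2 * (∑ g : Fin 6, v g * (s k g + (2 : ℝ)⁻¹ ^ 27 * p)) ^ 2 else e) +
        (if flag k = true then (10 : ℝ) else 1) * R) =
      ∑ k : Fin 10, w k * (if flag k = true then 5 / 2 * (∑ g : Fin 6, v g * (s k g + (2 : ℝ)⁻¹ ^ 27 * p)) ^ 2 else e) +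
        (∑ k : Fin 10, w k * (if flag k = true then (10 : ℝ) else 1)) * R := by
    rw [Finset.sum_mul, ← Finset.sum_add_distrib]
    refine Finset.sum_congr rfl fun k _ => ?_
    ring
  have hρR : (wc + ∑ k : Fin 10, w k * (if flag k = true then (10 : ℝ) else 1)) * R ≤ ρ * R :=
    mul_le_mul_of_nonneg_right hρ hR0
  calc ∑ n ∈ T, 467 / 45 * (if |(n : ℝ)| < 200 then 0.0396607 / (|(n : ℝ)| - 108.5) else 0.0768758 / (|(n : ℝ)| - 22) : ℝ) / (if |(|n| - 8 * |p|)| ≤ 24 then (1 : ℝ) else if |(|n| - 8 * |p|)| ≤ 56 then 2 / 5 else 1 / 9) * c n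
      ≤ wc * ∑ n ∈ T, c n + ∑ k : Fin 10, w k * ∑ n ∈ T.filter (fun n => n₁ k ≤ |n| ∧ |n| ≤ n₂ k), c n := by rw [← hexp]; exact hmain
    _ ≤ wc * (e + R) + (∑ k : Fin 10, w k * (if flag k = true then 5 / 2 * (∑ g : Fin 6, v g * (s k g + (2 : ℝ)⁻¹ ^ 27 * p)) ^ 2 else e) +
        (∑ k : Fin 10, w k * (if flag k = true then (10 : ℝ) else 1)) * R) := by
          rw [← halg]; exact add_le_add (mul_le_mul_of_nonneg_left htot hwc0) hsum2
    _ = (wc * e + ∑ k : Fin 10, w k * (if flag k = true then 5 / 2 * (∑ g : Fin 6, v g * (s k g + (2 : ℝ)⁻¹ ^ 27 * p)) ^ 2 else e)) +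
        (wc + ∑ k : Fin 10, w k * (if flag k = true then (10 : ℝ) else 1)) * R := by ring
    _ ≤ V0 + ρ * R := add_le_add hV0 hρR

end Cascade

end Summit.AnomalousDissipation.AnomalousDissipation.Theorems.SawtoothPulseCascade.K1Start
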